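import Mathlib.Data.ZMod.Basic
import Mathlib.Data.Fintype.Perm
import Literature.NumberTheory.LFunctions.AutomaticSequenceTransducerPeriod
import HarnessLib

/-!
# The groups of the naturally induced transducer (Müllner 2017, Lemma 2.3, Lemmas 2.10–2.12; proved)

Everything in this file is PROVED (plus plain definitions). It continues §2.3 of C. Müllner,
*Automatic sequences fulfill the Sarnak conjecture* (Duke Math. J. 166 (2017)) for the transducer
`MinImage δ` (`AutomaticSequenceTransducer.lean`) with period `d = transducerPeriod k δ`
(`AutomaticSequenceTransducerPeriod.lean`). As there, PATHS ARE DIGIT WORDS (letters `< k`) and the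
lemmas needing return paths assume that the letters `≥ k` act trivially
(`htriv : ∀ q d, k ≤ d → δ q d = q`, the convention `digitRestrict`):

* **Lemma 2.3** (`MinImage.exists_forall_exists_next_eq`): digit paths of EVERY large length
  between any two states (zeros, a synchronizing word, then a path to the target);
* `MinImage.pathOutputs k M M' c = G_{q q̄}(ℓ)`: the outputs `T(M, w)` of the digit paths from `M`
  to `M'` of length `≡ c (mod d)` (`c : ZMod d`); non-empty (`pathOutputs_nonempty`), inverses
  (`symm_mem_pathOutputs`: `G_{q q̄}(ℓ)⁻¹ = G_{q̄ q}(−ℓ)`), and **Lemma 2.11**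
  (`trans_mem_pathOutputs`, `exists_trans_eq_of_mem_pathOutputs`:
  `G_{q₁q₃}(ℓ₁+ℓ₂) = G_{q₁q₂}(ℓ₁) · G_{q₂q₃}(ℓ₂)`, `card_pathOutputs_eq`: all these sets have the
  same size), the coset structure `pathOutputs_eq_image_trans` (Remark after Lemma 2.11);
* **Corollary 2.12** (`MinImage.loopGroup`): `G_q = G_{qq}(0)` is a subgroup of `Perm (Fin n₀)`;
* **Theorem 2.7 (2) at a state** (`MinImage.exists_forall_exists_loop_eq`): there is `m₀` with
  `{T(M, w) : w ∈ Σ^{n d}, δ(M, w) = M} = G_q` for all `n ≥ m₀` (Lemma 2.10 with Lemma 2.9);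
* **Lemma 2.10, uniform** (`MinImage.exists_forall_realize`) and **Lemma 2.13**
  (`MinImage.exists_two_paths`: two different digit paths of the same length realising the same
  `g ∈ G_{q q̄}(ℓ)`, for `k ≥ 2`).

Conventions: outputs compose as `Equiv.trans` read along the path (`MinImage.T_append`), so
products of path sets are `{g₁ ≫ g₂}`. The relabelling Lemma 2.14 / Prop. 2.15 and Thm. 2.7 (1)
are in `AutomaticSequenceTransducerRelabel.lean`.

## References
* C. Müllner, Duke Math. J. 166 (2017), Lemma 2.3; §2.3: Lemmas 2.10, 2.11, Cor. 2.12, Thm. 2.7.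
  [Mullner2017]
-/

noncomputable section

open Finset

namespace Literature.NumberTheory.LFunctions

namespace MinImage

variable {σ : Type*} [Fintype σ] [DecidableEq σ] {δ : σ → ℕ → σ} {k : ℕ}

/-! ## Lemma 2.3: digit paths of every large length -/

/-- A minimising word sends every state to the base image `δ(σ, w₀)`. [folklore] -/
theorem next_eq_of_minimising (M : MinImage δ) {w₀ : List ℕ}
    (h₀ : (fullImage δ w₀).card = minRank δ) :
    M.next w₀ = ⟨fullImage δ w₀, fullImage_mem_minImages h₀⟩ :=
  Subtype.ext (image_eq_fullImage_of_card M.2 h₀)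

/-- Filtering to digits does not change `δ(σ, w)` when the letters `≥ k` act trivially. [folklore] -/
theorem fullImage_filter (htriv : ∀ q d, k ≤ d → δ q d = q) (u : List ℕ) :
    fullImage δ (u.filter (· < k)) = fullImage δ u :=
  image_congr fun q _ => (wordAct_filter_of_trivial htriv u q).symm

/-- **Müllner 2017, Lemma 2.3**: there is `N₀` such that any two states of the transducer are joined
by a DIGIT path of every length `n ≥ N₀` (zeros, then a synchronizing word, then a path to the
target). [cite: Mullner2017, Lemma 2.3] -/
theorem exists_forall_exists_next_eq (hk : 0 < k) (htriv : ∀ q d, k ≤ d → δ q d = q) :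
    ∃ N₀ : ℕ, ∀ (M M' : MinImage δ) (n : ℕ), N₀ ≤ n →
      ∃ w : List ℕ, (∀ d ∈ w, d < k) ∧ w.length = n ∧ M.next w = M' := by
  obtain ⟨w₁, h₁⟩ := exists_card_fullImage_eq_minRank δ
  set w₀ := w₁.filter (· < k) with hw₀
  have h₀ : (fullImage δ w₀).card = minRank δ := by rw [hw₀, fullImage_filter htriv]; exact h₁
  have hw₀d : ∀ d ∈ w₀, d < k := fun d hd => mem_filter_lt hd
  set M₀ : MinImage δ := ⟨fullImage δ w₀, fullImage_mem_minImages h₀⟩ with hM₀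
  have hu : ∀ M' : MinImage δ, ∃ u : List ℕ, (∀ d ∈ u, d < k) ∧ M₀.next u = M' := fun M' => by
    obtain ⟨u, hu⟩ := exists_image_eq M₀.2 M'.2
    exact ⟨u.filter (· < k), fun d hd => mem_filter_lt hd,
      by rw [next_filter htriv]; exact Subtype.ext hu⟩
  choose u hud hu using hu
  refine ⟨w₀.length + univ.sup fun M' => (u M').length, fun M M' n hn => ?_⟩
  have hle : (u M').length ≤ univ.sup fun M' => (u M').length :=
    le_sup (f := fun M' => (u M').length) (mem_univ M')
  refine ⟨List.replicate (n - w₀.length - (u M').length) 0 ++ w₀ ++ u M', ?_, ?_, ?_⟩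
  · refine digits_append (digits_append (fun d hd => ?_) hw₀d) (hud M')
    rw [List.eq_of_mem_replicate hd]; exact hk
  · simp only [List.length_append, List.length_replicate]
    omega
  · rw [next_append, next_append, next_eq_of_minimising _ h₀, ← hM₀, hu]

/-! ## The path sets `G_{q q̄}(ℓ)` -/

/-- `G_{q q̄}(ℓ)`: the outputs of the digit paths from `M` to `M'` of length `≡ c (mod d(A))`
(Müllner §2.3: `M_{q q̄, ℓ}` and `G_{q q̄}(ℓ) = ⋃_{ℓ' ≡ ℓ (d)} M_{q q̄, ℓ'}`). [cite: Mullner2017, §2.3] -/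
def pathOutputs (k : ℕ) (M M' : MinImage δ) (c : ZMod (transducerPeriod k δ)) :
    Finset (Equiv.Perm (Fin (minRank δ))) := by
  classical
  exact univ.filter fun g => ∃ w : List ℕ, (∀ d ∈ w, d < k) ∧
    (w.length : ZMod (transducerPeriod k δ)) = c ∧ M.next w = M' ∧ M.T w = g

/-- Membership in `G_{q q̄}(ℓ)`. [folklore] -/
theorem mem_pathOutputs {M M' : MinImage δ} {c : ZMod (transducerPeriod k δ)}
    {g : Equiv.Perm (Fin (minRank δ))} :
    g ∈ M.pathOutputs k M' c ↔ ∃ w : List ℕ, (∀ d ∈ w, d < k) ∧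
      (w.length : ZMod (transducerPeriod k δ)) = c ∧ M.next w = M' ∧ M.T w = g := by
  classical
  simp [pathOutputs]

/-- The output of a digit path lies in the corresponding path set. [folklore] -/
theorem T_mem_pathOutputs (M : MinImage δ) {w : List ℕ} (hw : ∀ d ∈ w, d < k) :
    M.T w ∈ M.pathOutputs k (M.next w) (w.length : ZMod (transducerPeriod k δ)) :=
  mem_pathOutputs.2 ⟨w, hw, rfl, rfl, rfl⟩

/-- Every path set is non-empty (Lemma 2.3 with a length in the prescribed class).
[cite: Mullner2017, Lemma 2.11 (proof, via Lemma 2.3)] -/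
theorem pathOutputs_nonempty (hk : 0 < k) (htriv : ∀ q d, k ≤ d → δ q d = q) (M M' : MinImage δ)
    (c : ZMod (transducerPeriod k δ)) : (M.pathOutputs k M' c).Nonempty := by
  obtain ⟨N₀, hN₀⟩ := exists_forall_exists_next_eq hk htriv
  haveI : NeZero (transducerPeriod k δ) := ⟨(transducerPeriod_pos hk htriv).ne'⟩
  obtain ⟨w, hwd, hw, hnext⟩ := hN₀ M M' (N₀ * transducerPeriod k δ + c.val)
    (by nlinarith [c.val.zero_le, transducerPeriod_pos hk htriv (δ := δ)])
  refine ⟨M.T w, mem_pathOutputs.2 ⟨w, hwd, ?_, hnext, rfl⟩⟩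
  rw [hw]
  push_cast
  rw [ZMod.natCast_self, mul_zero, zero_add, ZMod.natCast_zmod_val]

/-- Identity-loop lengths (digit words) are `≡ 0 (mod d)`. [folklore] -/
theorem natCast_length_eq_zero_of_isIdLoop (hk : 0 < k) (htriv : ∀ q d, k ≤ d → δ q d = q)
    {M : MinImage δ} {w : List ℕ} (hw : ∀ d ∈ w, d < k) (h : M.IsIdLoop w) :
    (w.length : ZMod (transducerPeriod k δ)) = 0 := by
  rw [ZMod.natCast_eq_zero_iff, ← M.period_eq_transducerPeriod hk htriv]
  exact period_dvd_of_mem ⟨w, hw, rfl, h⟩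

/-- **Inverses** (Müllner, proof of Lemma 2.11: `G_{q q̄}(ℓ)⁻¹ = G_{q̄ q}(−ℓ)`, via the inverse paths
of Lemma 2.8). [cite: Mullner2017, Lemma 2.11 (proof)] -/
theorem symm_mem_pathOutputs (hk : 0 < k) (htriv : ∀ q d, k ≤ d → δ q d = q) {M M' : MinImage δ}
    {c : ZMod (transducerPeriod k δ)} {g : Equiv.Perm (Fin (minRank δ))}
    (h : g ∈ M.pathOutputs k M' c) : g.symm ∈ M'.pathOutputs k M (-c) := by
  obtain ⟨w, hwd, hc, hnext, rfl⟩ := mem_pathOutputs.1 h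
  obtain ⟨wbar, hwbard, hloop⟩ := M.exists_isIdLoop_append htriv hwd
  have hnext' : M'.next wbar = M := by rw [← hnext, ← next_append]; exact hloop.1
  have hT : (M.T w).trans (M'.T wbar) = 1 := by rw [← hnext, ← T_append]; exact hloop.2
  refine mem_pathOutputs.2 ⟨wbar, hwbard, ?_, hnext', ?_⟩
  · have h0 := natCast_length_eq_zero_of_isIdLoop hk htriv (digits_append hwd hwbard) hloop
    rw [List.length_append, Nat.cast_add, hc] at h0
    exact eq_neg_of_add_eq_zero_right h0
  · calc M'.T wbar = (M.T w).symm.trans ((M.T w).trans (M'.T wbar)) := by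
          rw [← Equiv.trans_assoc, Equiv.symm_trans_self, Equiv.refl_trans]
      _ = (M.T w).symm := by rw [hT, Equiv.Perm.one_def, Equiv.trans_refl]

/-- **Products, ⊇** (trivial direction of Lemma 2.11): `G_{q₁q₂}(ℓ₁) · G_{q₂q₃}(ℓ₂) ⊆ G_{q₁q₃}(ℓ₁+ℓ₂)`.
[cite: Mullner2017, Lemma 2.11] -/
theorem trans_mem_pathOutputs {M₁ M₂ M₃ : MinImage δ} {c₁ c₂ : ZMod (transducerPeriod k δ)}
    {g₁ g₂ : Equiv.Perm (Fin (minRank δ))} (h₁ : g₁ ∈ M₁.pathOutputs k M₂ c₁)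
    (h₂ : g₂ ∈ M₂.pathOutputs k M₃ c₂) : g₁.trans g₂ ∈ M₁.pathOutputs k M₃ (c₁ + c₂) := by
  obtain ⟨w₁, hw₁d, hc₁, hn₁, rfl⟩ := mem_pathOutputs.1 h₁
  obtain ⟨w₂, hw₂d, hc₂, hn₂, rfl⟩ := mem_pathOutputs.1 h₂
  refine mem_pathOutputs.2 ⟨w₁ ++ w₂, digits_append hw₁d hw₂d, ?_, ?_, ?_⟩
  · rw [List.length_append, Nat.cast_add, hc₁, hc₂]
  · rw [next_append, hn₁, hn₂]
  · rw [T_append, hn₁]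

/-- **Müllner 2017, Lemma 2.11 (products, ⊆)**: every `g ∈ G_{q₁q₃}(ℓ₁+ℓ₂)` factors as `g₁ ≫ g₂`
with `g₁ ∈ G_{q₁q₂}(ℓ₁)`, `g₂ ∈ G_{q₂q₃}(ℓ₂)`, for ANY intermediate state `q₂`: take any path `w₁`
to `q₂` in the class `ℓ₁`, its inverse `w̄₁`, and `w₂ = w̄₁ w`. [cite: Mullner2017, Lemma 2.11] -/
theorem exists_trans_eq_of_mem_pathOutputs (hk : 0 < k) (htriv : ∀ q d, k ≤ d → δ q d = q)
    {M₁ M₃ : MinImage δ} (M₂ : MinImage δ) {c₁ c₂ : ZMod (transducerPeriod k δ)}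
    {g : Equiv.Perm (Fin (minRank δ))} (h : g ∈ M₁.pathOutputs k M₃ (c₁ + c₂)) :
    ∃ g₁ ∈ M₁.pathOutputs k M₂ c₁, ∃ g₂ ∈ M₂.pathOutputs k M₃ c₂, g₁.trans g₂ = g := by
  obtain ⟨w, hwd, hc, hnext, rfl⟩ := mem_pathOutputs.1 h
  obtain ⟨g₁, hg₁⟩ := pathOutputs_nonempty hk htriv M₁ M₂ c₁
  obtain ⟨w₁, hw₁d, hc₁, hn₁, rfl⟩ := mem_pathOutputs.1 hg₁
  obtain ⟨wbar, hwbard, hloop⟩ := M₁.exists_isIdLoop_append htriv hw₁d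
  have hnbar : M₂.next wbar = M₁ := by rw [← hn₁, ← next_append]; exact hloop.1
  refine ⟨M₁.T w₁, hg₁, M₂.T (wbar ++ w),
    mem_pathOutputs.2 ⟨wbar ++ w, digits_append hwbard hwd, ?_, ?_, rfl⟩, ?_⟩
  · have h0 := natCast_length_eq_zero_of_isIdLoop hk htriv (digits_append hw₁d hwbard) hloop
    rw [List.length_append, Nat.cast_add, hc₁] at h0
    rw [List.length_append, Nat.cast_add, hc, eq_neg_of_add_eq_zero_right h0]
    ring
  · rw [next_append, hnbar, hnext]
  · rw [← hn₁, ← T_append, ← List.append_assoc, T_append, hloop.1, hloop.2]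
    rfl

/-- Right translation by an element of `G_{q₂q₃}(ℓ₂)` maps `G_{q₁q₂}(ℓ₁)` into `G_{q₁q₃}(ℓ₁+ℓ₂)`
injectively; hence `|G_{q₁q₃}(ℓ₁+ℓ₂)| ≥ |G_{q₁q₂}(ℓ₁)|`. [cite: Mullner2017, Lemma 2.11 (proof)] -/
theorem card_pathOutputs_le_left (hk : 0 < k) (htriv : ∀ q d, k ≤ d → δ q d = q)
    (M₁ M₂ M₃ : MinImage δ) (c₁ c₂ : ZMod (transducerPeriod k δ)) :
    (M₁.pathOutputs k M₂ c₁).card ≤ (M₁.pathOutputs k M₃ (c₁ + c₂)).card := by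
  obtain ⟨g₂, hg₂⟩ := pathOutputs_nonempty hk htriv M₂ M₃ c₂
  calc (M₁.pathOutputs k M₂ c₁).card = ((M₁.pathOutputs k M₂ c₁).image fun g => g.trans g₂).card :=
        (card_image_of_injective _ fun a b hab => by
          have h := congrArg (fun e : Equiv.Perm (Fin (minRank δ)) => e.trans g₂.symm) hab
          simpa only [Equiv.trans_assoc, Equiv.self_trans_symm, Equiv.trans_refl] using h).symm
    _ ≤ (M₁.pathOutputs k M₃ (c₁ + c₂)).card :=
        card_le_card (image_subset_iff.2 fun g hg => trans_mem_pathOutputs hg hg₂)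

/-- Left translation: `|G_{q₁q₃}(ℓ₁+ℓ₂)| ≥ |G_{q₂q₃}(ℓ₂)|`. [cite: Mullner2017, Lemma 2.11 (proof)] -/
theorem card_pathOutputs_le_right (hk : 0 < k) (htriv : ∀ q d, k ≤ d → δ q d = q)
    (M₁ M₂ M₃ : MinImage δ) (c₁ c₂ : ZMod (transducerPeriod k δ)) :
    (M₂.pathOutputs k M₃ c₂).card ≤ (M₁.pathOutputs k M₃ (c₁ + c₂)).card := by
  obtain ⟨g₁, hg₁⟩ := pathOutputs_nonempty hk htriv M₁ M₂ c₁
  calc (M₂.pathOutputs k M₃ c₂).card = ((M₂.pathOutputs k M₃ c₂).image fun g => g₁.trans g).card :=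
        (card_image_of_injective _ fun a b hab => by
          have h := congrArg (fun e : Equiv.Perm (Fin (minRank δ)) => g₁.symm.trans e) hab
          simpa only [← Equiv.trans_assoc, Equiv.symm_trans_self, Equiv.refl_trans] using h).symm
    _ ≤ (M₁.pathOutputs k M₃ (c₁ + c₂)).card :=
        card_le_card (image_subset_iff.2 fun g hg => trans_mem_pathOutputs hg₁ hg)

/-- **Müllner 2017, Lemma 2.11 (second part)**: all path sets have the same size,
`|G_{q q̄}(ℓ)| = |G_{q₀q₀}(0)|`. [cite: Mullner2017, Lemma 2.11] -/
theorem card_pathOutputs_eq (hk : 0 < k) (htriv : ∀ q d, k ≤ d → δ q d = q)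
    (M M' M₀ : MinImage δ) (c : ZMod (transducerPeriod k δ)) :
    (M.pathOutputs k M' c).card = (M₀.pathOutputs k M₀ 0).card := by
  apply le_antisymm
  · calc (M.pathOutputs k M' c).card ≤ (M.pathOutputs k M (c + -c)).card :=
          card_pathOutputs_le_left hk htriv M M' M c (-c)
      _ ≤ (M₀.pathOutputs k M (0 + (c + -c))).card := card_pathOutputs_le_right hk htriv M₀ M M 0 _
      _ ≤ (M₀.pathOutputs k M₀ (0 + (c + -c) + 0)).card :=
          card_pathOutputs_le_left hk htriv M₀ M M₀ _ 0
      _ = (M₀.pathOutputs k M₀ 0).card := by rw [add_neg_cancel, add_zero, add_zero]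
  · calc (M₀.pathOutputs k M₀ 0).card ≤ (M₀.pathOutputs k M' (0 + 0)).card :=
          card_pathOutputs_le_left hk htriv M₀ M₀ M' 0 0
      _ ≤ (M.pathOutputs k M' (c + (0 + 0))).card := card_pathOutputs_le_right hk htriv M M₀ M' c _
      _ = (M.pathOutputs k M' c).card := by rw [add_zero, add_zero]

/-- **The coset structure** (Remark after Lemma 2.11: `G_{q₁q₃}(ℓ₁+ℓ₂) = G_{q₁q₂}(ℓ₁) · g₂` for any
`g₂ ∈ G_{q₂q₃}(ℓ₂)`). [cite: Mullner2017, Lemma 2.11 (Remark)] -/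
theorem pathOutputs_eq_image_trans (hk : 0 < k) (htriv : ∀ q d, k ≤ d → δ q d = q)
    {M₁ M₂ M₃ : MinImage δ} {c₁ c₂ : ZMod (transducerPeriod k δ)}
    {g₂ : Equiv.Perm (Fin (minRank δ))} (hg₂ : g₂ ∈ M₂.pathOutputs k M₃ c₂) :
    M₁.pathOutputs k M₃ (c₁ + c₂) = (M₁.pathOutputs k M₂ c₁).image fun g => g.trans g₂ := by
  symm
  apply eq_of_subset_of_card_le (image_subset_iff.2 fun g hg => trans_mem_pathOutputs hg hg₂)
  rw [card_image_of_injective _ fun a b hab => by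
    have h := congrArg (fun e : Equiv.Perm (Fin (minRank δ)) => e.trans g₂.symm) hab
    simpa only [Equiv.trans_assoc, Equiv.self_trans_symm, Equiv.trans_refl] using h]
  rw [card_pathOutputs_eq hk htriv M₁ M₃ M₁, card_pathOutputs_eq hk htriv M₁ M₂ M₁]

/-! ## Corollary 2.12: the group `G_q` -/

/-- **Müllner 2017, Corollary 2.12**: `G_q = G_{qq}(0)`, the outputs of the digit loops at `M` of
length divisible by `d(A)`, form a subgroup of `Perm (Fin n₀)` (letters `≥ k` acting trivially).
[cite: Mullner2017, Cor. 2.12] -/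
def loopGroup (hk : 0 < k) (htriv : ∀ q d, k ≤ d → δ q d = q) (M : MinImage δ) :
    Subgroup (Equiv.Perm (Fin (minRank δ))) where
  carrier := ↑(M.pathOutputs k M 0)
  one_mem' := by
    rw [mem_coe]
    exact mem_pathOutputs.2 ⟨[], by simp, by simp, M.next_nil, M.T_nil⟩
  mul_mem' := by
    intro f g hf hg
    rw [mem_coe] at hf hg ⊢
    have := trans_mem_pathOutputs hg hf
    rwa [add_zero, ← Equiv.Perm.mul_def] at this
  inv_mem' := by
    intro g hg
    rw [mem_coe] at hg ⊢
    have := symm_mem_pathOutputs hk htriv hg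
    rwa [neg_zero, ← Equiv.Perm.inv_def] at this

/-- Membership in `G_q`. [folklore] -/
theorem mem_loopGroup {hk : 0 < k} {htriv : ∀ q d, k ≤ d → δ q d = q} {M : MinImage δ}
    {g : Equiv.Perm (Fin (minRank δ))} :
    g ∈ M.loopGroup hk htriv ↔ g ∈ M.pathOutputs k M 0 := Iff.rfl

/-- Outputs of digit loops of length divisible by `d` lie in `G_q`. [folklore] -/
theorem T_mem_loopGroup {hk : 0 < k} {htriv : ∀ q d, k ≤ d → δ q d = q} {M : MinImage δ}
    {w : List ℕ} (hw : ∀ d ∈ w, d < k) (hnext : M.next w = M)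
    (hlen : transducerPeriod k δ ∣ w.length) : M.T w ∈ M.loopGroup hk htriv :=
  mem_loopGroup.2 (mem_pathOutputs.2 ⟨w, hw, (ZMod.natCast_eq_zero_iff _ _).2 hlen, hnext, rfl⟩)

/-! ## Theorem 2.7 (2) at a state: every element of `G_q` by loops of every large length -/

/-- **Müllner 2017, Theorem 2.7 (2), loops at a fixed state** (Lemma 2.10 with Lemma 2.9): there is
`m₀` such that for every `n ≥ m₀` and every `g ∈ G_q` there is a digit loop `w` at `M` of length
exactly `n · d(A)` with `T(M, w) = g`; i.e. `{T(M,w) : w ∈ Σ^{n d}, δ(M,w) = M} = G_q` for `n ≥ m₀`.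
[cite: Mullner2017, Thm. 2.7] -/
theorem exists_forall_exists_loop_eq (hk : 0 < k) (htriv : ∀ q d, k ≤ d → δ q d = q)
    (M : MinImage δ) :
    ∃ m₀ : ℕ, ∀ n : ℕ, m₀ ≤ n → ∀ g ∈ M.loopGroup hk htriv,
      ∃ w : List ℕ, (∀ d ∈ w, d < k) ∧ w.length = n * transducerPeriod k δ ∧
        M.next w = M ∧ M.T w = g := by
  set d := transducerPeriod k δ with hd
  have hdpos : 0 < d := transducerPeriod_pos hk htriv
  obtain ⟨n₀, hn₀⟩ := M.exists_mem_loopLengths_of_ge k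
  -- a realising loop for each element of the (finite) group
  have hreal : ∀ g : Equiv.Perm (Fin (minRank δ)), ∃ w : List ℕ, g ∈ M.loopGroup hk htriv →
      (∀ x ∈ w, x < k) ∧ (w.length : ZMod d) = 0 ∧ M.next w = M ∧ M.T w = g := by
    intro g
    by_cases hg : g ∈ M.loopGroup hk htriv
    · obtain ⟨w, hw⟩ := mem_pathOutputs.1 (mem_loopGroup.1 hg)
      exact ⟨w, fun _ => hw⟩
    · exact ⟨[], fun h => absurd h hg⟩
  choose wg hwg using hreal
  refine ⟨n₀ + univ.sup fun g => (wg g).length, fun n hn g hg => ?_⟩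
  obtain ⟨hwd, hc, hnext, hT⟩ := hwg g hg
  have hle : (wg g).length ≤ univ.sup fun g => (wg g).length :=
    le_sup (f := fun g => (wg g).length) (mem_univ g)
  have hdvd : d ∣ (wg g).length := (ZMod.natCast_eq_zero_iff _ _).1 hc
  have h1 : n ≤ n * d := Nat.le_mul_of_pos_right n hdpos
  -- an identity loop of the complementary length
  have hlen : n₀ ≤ n * d - (wg g).length := by omega
  have hdvd' : M.period k ∣ n * d - (wg g).length := by
    rw [M.period_eq_transducerPeriod hk htriv, ← hd]
    exact Nat.dvd_sub (dvd_mul_left d n) hdvd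
  obtain ⟨v, hvd, hv, hloop⟩ := hn₀ _ hlen hdvd'
  refine ⟨v ++ wg g, digits_append hvd hwd, ?_, ?_, ?_⟩
  · rw [List.length_append, hv]
    omega
  · rw [next_append, hloop.1, hnext]
  · rw [T_append, hloop.1, hloop.2, hT]
    rfl

/-! ## Lemma 2.10 (uniform) and Lemma 2.13 (two distinct paths) -/

/-- **Müllner 2017, Lemma 2.10, uniformly** ("`m₁`" in the proof of Lemma 2.13): there is `m₁` such
that every `g ∈ G_{q q̄}(ℓ)` is realised by digit paths from `q` to `q̄` of EVERY length
`ℓ' + K d` with `K ≥ m₁`, where `ℓ' < d` is the residue of the class (prepend identity loops of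
all large lengths, Lemma 2.9). [cite: Mullner2017, Lemma 2.10] -/
theorem exists_forall_realize (hk : 0 < k) (htriv : ∀ q d, k ≤ d → δ q d = q) :
    ∃ m₁ : ℕ, ∀ (M M' : MinImage δ) (c : ZMod (transducerPeriod k δ)) (g : Equiv.Perm (Fin (minRank δ))),
      g ∈ M.pathOutputs k M' c → ∀ K : ℕ, m₁ ≤ K →
        ∃ w : List ℕ, (∀ d ∈ w, d < k) ∧ w.length = c.val + K * transducerPeriod k δ ∧
          M.next w = M' ∧ M.T w = g := by
  set d := transducerPeriod k δ with hd
  have hdpos : 0 < d := transducerPeriod_pos hk htriv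
  haveI : NeZero d := ⟨hdpos.ne'⟩
  -- per-tuple thresholds
  have hone : ∀ (M M' : MinImage δ) (c : ZMod d) (g : Equiv.Perm (Fin (minRank δ))),
      ∃ m : ℕ, g ∈ M.pathOutputs k M' c → ∀ K : ℕ, m ≤ K →
        ∃ w : List ℕ, (∀ x ∈ w, x < k) ∧ w.length = c.val + K * d ∧ M.next w = M' ∧ M.T w = g := by
    intro M M' c g
    by_cases hg : g ∈ M.pathOutputs k M' c
    · obtain ⟨w, hwd, hc, hnext, hT⟩ := mem_pathOutputs.1 hg
      obtain ⟨n₀, hn₀⟩ := M.exists_mem_loopLengths_of_ge k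
      -- `|w| = c.val + j d`
      have hmod : w.length % d = c.val := by
        rw [← hc, ZMod.val_natCast]
      obtain ⟨j, hj⟩ : ∃ j, w.length = c.val + j * d :=
        ⟨w.length / d, by rw [← hmod, mul_comm]; exact (Nat.mod_add_div _ _).symm⟩
      refine ⟨j + n₀, fun _ K hK => ?_⟩
      have hlen : n₀ ≤ (K - j) * d := by
        calc n₀ ≤ K - j := by omega
          _ ≤ (K - j) * d := Nat.le_mul_of_pos_right _ hdpos
      have hdvd' : M.period k ∣ (K - j) * d := by
        rw [M.period_eq_transducerPeriod hk htriv, ← hd]; exact dvd_mul_left d _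
      obtain ⟨v, hvd, hv, hloop⟩ := hn₀ _ hlen hdvd'
      refine ⟨v ++ w, digits_append hvd hwd, ?_, ?_, ?_⟩
      · rw [List.length_append, hv, hj]
        have : (K - j) * d + j * d = K * d := by
          rw [← Nat.add_mul]; congr 1; omega
        omega
      · rw [next_append, hloop.1, hnext]
      · rw [T_append, hloop.1, hloop.2, hT]; rfl
    · exact ⟨0, fun h => absurd h hg⟩
  choose m hm using hone
  refine ⟨univ.sup fun t : MinImage δ × MinImage δ × ZMod d × Equiv.Perm (Fin (minRank δ)) =>
    m t.1 t.2.1 t.2.2.1 t.2.2.2, fun M M' c g hg K hK => hm M M' c g hg K ?_⟩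
  exact (le_sup (f := fun t : MinImage δ × MinImage δ × ZMod d × Equiv.Perm (Fin (minRank δ)) =>
    m t.1 t.2.1 t.2.2.1 t.2.2.2) (mem_univ (M, M', c, g))).trans hK

/-- **Müllner 2017, Lemma 2.13 (two distinct paths)**, digit alphabet with `k ≥ 2`: there is `m₀`
such that for all states `q, q̄`, classes `ℓ`, `g ∈ G_{q q̄}(ℓ)` and `K ≥ m₀` there are two
DIFFERENT digit words `w₁ ≠ w₂` of the same length `ℓ' + K d` leading from `q` to `q̄` with
`T(q, w_i) = g` (cases `|Q| ≥ 2` / `|G| ≥ 2` / both trivial, as printed, with `m₀ = 2 m₁`).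
[cite: Mullner2017, Lemma 2.13] -/
theorem exists_two_paths (hk : 2 ≤ k) (htriv : ∀ q d, k ≤ d → δ q d = q) :
    ∃ m₀ : ℕ, ∀ (M M' : MinImage δ) (c : ZMod (transducerPeriod k δ)) (g : Equiv.Perm (Fin (minRank δ))),
      g ∈ M.pathOutputs k M' c → ∀ K : ℕ, m₀ ≤ K →
        ∃ w₁ w₂ : List ℕ, w₁ ≠ w₂ ∧ (∀ d ∈ w₁, d < k) ∧ (∀ d ∈ w₂, d < k) ∧
          w₁.length = c.val + K * transducerPeriod k δ ∧ w₂.length = c.val + K * transducerPeriod k δ ∧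
          M.next w₁ = M' ∧ M.next w₂ = M' ∧ M.T w₁ = g ∧ M.T w₂ = g := by
  have hk0 : 0 < k := by omega
  have hdpos : 0 < transducerPeriod k δ := transducerPeriod_pos hk0 htriv
  haveI : NeZero (transducerPeriod k δ) := ⟨hdpos.ne'⟩
  have hcast0 : ∀ K : ℕ, ((K * transducerPeriod k δ : ℕ) : ZMod (transducerPeriod k δ)) = 0 :=
    fun K => by rw [Nat.cast_mul, ZMod.natCast_self, mul_zero]
  obtain ⟨m₁, hm₁⟩ := exists_forall_realize hk0 htriv (δ := δ)
  refine ⟨2 * m₁ + 1, fun M M' c g hg K hK => ?_⟩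
  -- split `K = K₁ + K₂` with `K₁, K₂ ≥ m₁`, `K₁ ≥ 1`: first leg of length `K₁ d` (class 0), second `c.val + K₂ d`
  set K₁ := m₁ + 1 with hK₁
  set K₂ := K - K₁ with hK₂
  have hK₂m : m₁ ≤ K₂ := by omega
  have hKsum : K₁ + K₂ = K := by omega
  -- a generic construction: first legs `u₁ ≠ u₂` (class 0, length K₁ d) to states `N₁, N₂` with outputs
  -- `h₁, h₂`, then second legs realising `h_i⁻¹ ≫ g`.
  have build : ∀ (N₁ N₂ : MinImage δ) (h₁ h₂ : Equiv.Perm (Fin (minRank δ))) (u₁ u₂ : List ℕ),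
      u₁ ≠ u₂ → (∀ x ∈ u₁, x < k) → (∀ x ∈ u₂, x < k) →
      u₁.length = K₁ * transducerPeriod k δ → u₂.length = K₁ * transducerPeriod k δ → M.next u₁ = N₁ → M.next u₂ = N₂ →
      M.T u₁ = h₁ → M.T u₂ = h₂ →
      ∃ w₁ w₂ : List ℕ, w₁ ≠ w₂ ∧ (∀ x ∈ w₁, x < k) ∧ (∀ x ∈ w₂, x < k) ∧
        w₁.length = c.val + K * transducerPeriod k δ ∧ w₂.length = c.val + K * transducerPeriod k δ ∧
        M.next w₁ = M' ∧ M.next w₂ = M' ∧ M.T w₁ = g ∧ M.T w₂ = g := by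
    intro N₁ N₂ h₁ h₂ u₁ u₂ hne hu₁d hu₂d hl₁ hl₂ hn₁ hn₂ hT₁ hT₂
    -- `h_i⁻¹ ≫ g ∈ G_{N_i M'}(c)` by Lemma 2.11
    have hmem : ∀ (N : MinImage δ) (h : Equiv.Perm (Fin (minRank δ))) (u : List ℕ),
        (∀ x ∈ u, x < k) → u.length = K₁ * transducerPeriod k δ → M.next u = N → M.T u = h →
        h.symm.trans g ∈ N.pathOutputs k M' c := by
      intro N h u hud hl hn hT
      have hu : h ∈ M.pathOutputs k N 0 := by
        rw [← hT, ← hn]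
        have := M.T_mem_pathOutputs hud (k := k)
        rwa [hl, hcast0] at this
      have hinv := symm_mem_pathOutputs hk0 htriv hu
      rw [neg_zero] at hinv
      have := trans_mem_pathOutputs hinv hg
      rwa [zero_add] at this
    obtain ⟨v₁, hv₁d, hv₁l, hv₁n, hv₁T⟩ := hm₁ N₁ M' c _ (hmem N₁ h₁ u₁ hu₁d hl₁ hn₁ hT₁) K₂ hK₂m
    obtain ⟨v₂, hv₂d, hv₂l, hv₂n, hv₂T⟩ := hm₁ N₂ M' c _ (hmem N₂ h₂ u₂ hu₂d hl₂ hn₂ hT₂) K₂ hK₂m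
    refine ⟨u₁ ++ v₁, u₂ ++ v₂, ?_, digits_append hu₁d hv₁d, digits_append hu₂d hv₂d, ?_, ?_, ?_, ?_, ?_, ?_⟩
    · intro heq
      have := List.append_inj_left heq (by rw [hl₁, hl₂])
      exact hne this
    · rw [List.length_append, hl₁, hv₁l, ← hKsum]; ring
    · rw [List.length_append, hl₂, hv₂l, ← hKsum]; ring
    · rw [next_append, hn₁, hv₁n]
    · rw [next_append, hn₂, hv₂n]
    · rw [T_append, hn₁, hT₁, hv₁T, ← Equiv.trans_assoc, Equiv.self_trans_symm, Equiv.refl_trans]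
    · rw [T_append, hn₂, hT₂, hv₂T, ← Equiv.trans_assoc, Equiv.self_trans_symm, Equiv.refl_trans]
  -- realising first legs of class 0 and length `K₁ d` at prescribed states/outputs
  have leg : ∀ (N : MinImage δ) (h : Equiv.Perm (Fin (minRank δ))), h ∈ M.pathOutputs k N 0 →
      ∃ u : List ℕ, (∀ x ∈ u, x < k) ∧ u.length = K₁ * transducerPeriod k δ ∧ M.next u = N ∧ M.T u = h := by
    intro N h hh
    obtain ⟨u, hud, hul, hun, huT⟩ := hm₁ M N 0 h hh K₁ (by omega)
    exact ⟨u, hud, by rw [hul, ZMod.val_zero, zero_add], hun, huT⟩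
  by_cases hQ : ∃ N : MinImage δ, N ≠ M
  · -- Case `|Q| ≥ 2`: first legs to two different states
    obtain ⟨N, hN⟩ := hQ
    obtain ⟨h₁, hh₁⟩ := pathOutputs_nonempty hk0 htriv M M 0
    obtain ⟨h₂, hh₂⟩ := pathOutputs_nonempty hk0 htriv M N 0
    obtain ⟨u₁, hu₁d, hl₁, hn₁, hT₁⟩ := leg M h₁ hh₁
    obtain ⟨u₂, hu₂d, hl₂, hn₂, hT₂⟩ := leg N h₂ hh₂
    refine build M N h₁ h₂ u₁ u₂ ?_ hu₁d hu₂d hl₁ hl₂ hn₁ hn₂ hT₁ hT₂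
    rintro rfl
    exact hN (hn₂.symm.trans hn₁)
  · simp only [not_exists, ne_eq, not_not] at hQ
    by_cases hG : ∃ h : Equiv.Perm (Fin (minRank δ)), h ∈ M.pathOutputs k M 0 ∧ h ≠ 1
    · -- Case `|G| ≥ 2`: first legs with two different outputs
      obtain ⟨h₂, hh₂, hne⟩ := hG
      have hh₁ : (1 : Equiv.Perm (Fin (minRank δ))) ∈ M.pathOutputs k M 0 :=
        mem_pathOutputs.2 ⟨[], by simp, by simp, M.next_nil, M.T_nil⟩
      obtain ⟨u₁, hu₁d, hl₁, hn₁, hT₁⟩ := leg M 1 hh₁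
      obtain ⟨u₂, hu₂d, hl₂, hn₂, hT₂⟩ := leg M h₂ hh₂
      refine build M M 1 h₂ u₁ u₂ ?_ hu₁d hu₂d hl₁ hl₂ hn₁ hn₂ hT₁ hT₂
      rintro rfl
      exact hne (hT₂.symm.trans hT₁)
    · -- Case `|Q| = |G| = 1`: any two different digit words of length `K₁ d ≥ 1` will do
      simp only [not_exists, not_and, ne_eq, not_not] at hG
      have hall : ∀ u : List ℕ, (∀ x ∈ u, x < k) → u.length = K₁ * transducerPeriod k δ →
          M.next u = M ∧ M.T u = 1 := by
        intro u hud hul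
        refine ⟨hQ _, hG _ ?_⟩
        have := M.T_mem_pathOutputs hud (k := k)
        rwa [hQ (M.next u), hul, hcast0] at this
      have hlen : 0 < K₁ * transducerPeriod k δ := Nat.mul_pos (by omega) hdpos
      set u₁ : List ℕ := List.replicate (K₁ * transducerPeriod k δ) 0
      set u₂ : List ℕ := 1 :: List.replicate (K₁ * transducerPeriod k δ - 1) 0
      have hu₁d : ∀ x ∈ u₁, x < k := fun x hx => by rw [List.eq_of_mem_replicate hx]; omega
      have hu₂d : ∀ x ∈ u₂, x < k := fun x hx => by
        rcases List.mem_cons.1 hx with rfl | h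
        · omega
        · rw [List.eq_of_mem_replicate h]; omega
      have hl₁ : u₁.length = K₁ * transducerPeriod k δ := List.length_replicate
      have hl₂ : u₂.length = K₁ * transducerPeriod k δ := by
        simp only [u₂, List.length_cons, List.length_replicate]; omega
      have hne : u₁ ≠ u₂ := by
        intro h
        have h' := congrArg List.head? h
        simp only [u₁, u₂, List.head?_cons] at h'
        rw [show K₁ * transducerPeriod k δ = K₁ * transducerPeriod k δ - 1 + 1 by omega, List.replicate_succ, List.head?_cons] at h'
        exact absurd (Option.some.inj h') (by norm_num)
      exact build M M 1 1 u₁ u₂ hne hu₁d hu₂d hl₁ hl₂ (hall u₁ hu₁d hl₁).1 (hall u₂ hu₂d hl₂).1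
        (hall u₁ hu₁d hl₁).2 (hall u₂ hu₂d hl₂).2

end MinImage

end Literature.NumberTheory.LFunctions
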